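import Summits.BirchSwinnertonDyer.BirchSwinnertonDyer.Theorems.Rank2Observatory2DescFunctionals
import HarnessLib

/-!
# BirchSwinnertonDyer — rank ≥ 2 observatory: KERNEL-2DESC-Z2, the real-sign functional

HONEST FRAMING: per-curve certified theorems and census instruments; no claim on BSD in rank ≥ 2.

Generic layer of the KERNEL-2DESC-Z2 instrument (design `b2b-bsdr2-cert-3/KERNEL-TRANSPORT.md`
§ KERNEL-2DESC-Z2; feasibility `code/b2b-bsdr2-cert-3/kernel-2desc-z2/README-Z2.md`). For
`y² = x³ + A x² + B x` and a real place `ρ` of `K = ℚ(θ)`, `θ² + Aθ + B = 0`, at which `ρ θ` is the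
SMALLER root and is negative (`2ρθ + A < 0`, `ρθ < 0`), every rational point has `x − ρθ > 0`
(if `x < ρθ` all three factors of `x(x − θ₁)(x − θ₂)` are negative). Hence the number of negative
factors in an admissible product `∏_T w · ∏_U g` is even: the sign functional `admSign`, with
soundness `admSign_sound` in the shape of hypothesis `hadm` of `mordellWeilRank_le_of_coverSet_z2`.
In the `μ_θ` presentation the norm functional is vacuous, so this and the finite local conditions
are the whole sieve.

Sorry-free; axioms `propext`, `Classical.choice`, `Quot.sound`. [folklore];
[cite: Cassels1991LecturesEllipticCurves, §15].
-/

-- single-conjunct summit: `Summit.BirchSwinnertonDyer.BirchSwinnertonDyer.…` repeats the name by design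
set_option linter.dupNamespace false

noncomputable section

open scoped Classical

open Summit.BirchSwinnertonDyer.BirchSwinnertonDyer.Rank2Observatory.TwoDescCubic

namespace Summit.BirchSwinnertonDyer.BirchSwinnertonDyer.Rank2Observatory.TwoDescZ2

variable {K : Type*} [Field K] [CharZero K] {m s : ℕ}

/-- **Positivity at the small real root.** If `ρθ < 0` is the smaller real root of `X² + AX + B`
(`2ρθ + A < 0`) and `θ ∉ ℚ`, every rational solution of `y² = x³ + Ax² + Bx` has `0 < x − ρθ`.
[folklore] -/
theorem sub_rho_theta_pos_z2 (ρ : K →+* ℝ) {A B : ℤ} {θ : K}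
    (hθ : θ ^ 2 + algebraMap ℚ K (A : ℚ) * θ + algebraMap ℚ K (B : ℚ) = 0)
    (hθQ : ∀ q : ℚ, algebraMap ℚ K q ≠ θ)
    (hneg : ρ θ < 0) (hsm : 2 * ρ θ + A < 0) {x y : ℚ}
    (hE : y ^ 2 = x ^ 3 + A * x ^ 2 + B * x) : 0 < ρ (algebraMap ℚ K x - θ) := by
  set t := ρ θ with ht_def
  have ht : t ^ 2 + (A : ℝ) * t + B = 0 := by
    have h := congrArg ρ hθ
    simpa [map_add, map_mul, map_pow, eq_ratCast, map_ratCast, map_intCast] using h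
  have hρx : ρ (algebraMap ℚ K x - θ) = (x : ℝ) - t := by
    simp [map_sub, eq_ratCast, map_ratCast, ht_def]
  rw [hρx]
  rcases lt_trichotomy (x : ℝ) t with hlt | heq | hgt
  · -- `x < t < 0`: all three factors negative, contradiction with `y² ≥ 0`
    exfalso
    have hE' : ((y : ℝ)) ^ 2 = (x : ℝ) ^ 3 + A * (x : ℝ) ^ 2 + B * x := by exact_mod_cast hE
    have h1 : 0 < ((x : ℝ) - t) * ((x : ℝ) + t + A) :=
      mul_pos_of_neg_of_neg (by linarith) (by linarith)
    have hq : 0 < (x : ℝ) ^ 2 + A * x + B := by nlinarith [h1, ht]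
    have hx : (x : ℝ) < 0 := by linarith
    have h3 : (x : ℝ) * ((x : ℝ) ^ 2 + A * x + B) < 0 := mul_neg_of_neg_of_pos hx hq
    nlinarith [sq_nonneg (y : ℝ), h3, hE']
  · -- `x = t`: then `θ` is rational, excluded
    exfalso
    have h0 : ρ (algebraMap ℚ K x - θ) = 0 := by rw [hρx, heq, sub_self]
    have h0' : algebraMap ℚ K x - θ = 0 := (map_eq_zero_iff ρ ρ.injective).mp h0
    exact hθQ x (sub_eq_zero.mp h0')
  · exact sub_pos.mpr hgt

/-- **The sign functional** on a pair `(T, U)`: the number of factors negative at the chosen real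
place is even. Computable (`decide`). [folklore] -/
def admSign (su : Fin m → Bool) (sg : Fin s → Bool) (T : Finset (Fin m)) (U : Finset (Fin s)) :
    Bool :=
  decide (Even ((T.filter fun i => su i = true).card + (U.filter fun j => sg j = true).card))

/-- The empty pair passes the sign functional. [folklore] -/
theorem admSign_empty (su : Fin m → Bool) (sg : Fin s → Bool) : admSign su sg ∅ ∅ = true := by
  simp [admSign]

/-- **Soundness of the sign functional** (shape of `hadm` in `mordellWeilRank_le_of_coverSet_z2`):
with sign bits (`true` = negative) at a real place `ρ` where `ρθ < 0` is the smaller root, every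
pair `(T, U)` realised by a rational point passes `admSign`.
[cite: Cassels1991LecturesEllipticCurves, §15] -/
theorem admSign_sound (ρ : K →+* ℝ) {A B : ℤ} {θ : K}
    (hθ : θ ^ 2 + algebraMap ℚ K (A : ℚ) * θ + algebraMap ℚ K (B : ℚ) = 0)
    (hθQ : ∀ q : ℚ, algebraMap ℚ K q ≠ θ)
    (hneg : ρ θ < 0) (hsm : 2 * ρ θ + A < 0)
    {w : Fin m → K} {g : Fin s → K} (hw0 : ∀ i, w i ≠ 0) (hg0 : ∀ j, g j ≠ 0)
    {su : Fin m → Bool} (hsu : ∀ i, su i = true ↔ ρ (w i) < 0)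
    {sg : Fin s → Bool} (hsg : ∀ j, sg j = true ↔ ρ (g j) < 0)
    (x y : ℚ) (hE : y ^ 2 = x ^ 3 + A * x ^ 2 + B * x) (T : Finset (Fin m)) (U : Finset (Fin s))
    (hsq : IsSquare ((algebraMap ℚ K x - θ) * (∏ i ∈ T, w i) * ∏ j ∈ U, g j)) :
    admSign su sg T U = true := by
  set z := (∏ i ∈ T, w i) * ∏ j ∈ U, g j with hz
  have hsq' : IsSquare ((algebraMap ℚ K x - θ) * z) := by rwa [hz, ← mul_assoc]
  have hz0 : z ≠ 0 := mul_ne_zero (Finset.prod_ne_zero_iff.mpr fun i _ => hw0 i)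
    (Finset.prod_ne_zero_iff.mpr fun j _ => hg0 j)
  rw [admSign, decide_eq_true_eq]
  have hξ := sub_rho_theta_pos_z2 ρ hθ hθQ hneg hsm hE
  have hρz := rho_pos_of_isSquare_mul ρ hξ hz0 hsq'
  rw [hz, map_mul, map_prod, map_prod] at hρz
  have h1 := prod_pos_iff_even_card_neg T (fun i => ρ (w i)) (fun i => (map_ne_zero ρ).mpr (hw0 i))
  have h2 := prod_pos_iff_even_card_neg U (fun j => ρ (g j)) (fun j => (map_ne_zero ρ).mpr (hg0 j))
  have hfT : T.filter (fun i => su i = true) = T.filter (fun i => ρ (w i) < 0) :=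
    Finset.filter_congr (fun i _ => hsu i)
  have hfU : U.filter (fun j => sg j = true) = U.filter (fun j => ρ (g j) < 0) :=
    Finset.filter_congr (fun j _ => hsg j)
  rw [hfT, hfU, Nat.even_add, ← h1, ← h2]
  rw [mul_pos_iff] at hρz
  rcases hρz with ⟨ha, hb⟩ | ⟨ha, hb⟩
  · exact iff_of_true ha hb
  · exact iff_of_false (not_lt.mpr ha.le) (not_lt.mpr hb.le)

/-- **Conjunction of sieves**: if two admissibility tests are each sound for rational points, so is
their conjunction (used to combine `admSign` with the finite local conditions). [folklore] -/
theorem adm_and_sound {P : Finset (Fin m) → Finset (Fin s) → Prop}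
    {adm₁ adm₂ : Finset (Fin m) → Finset (Fin s) → Bool}
    (h₁ : ∀ T U, P T U → adm₁ T U = true) (h₂ : ∀ T U, P T U → adm₂ T U = true) :
    ∀ T U, P T U → (adm₁ T U && adm₂ T U) = true := by
  intro T U hP
  rw [Bool.and_eq_true]
  exact ⟨h₁ T U hP, h₂ T U hP⟩

end Summit.BirchSwinnertonDyer.BirchSwinnertonDyer.Rank2Observatory.TwoDescZ2

end
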